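import Summits.CriticalPhenomena.PercolationContinuityZ3.Theorems.PercNearOneGluingNoHeavyLowerTailIncStarSlackEdgeBase
import Summits.CriticalPhenomena.PercolationContinuityZ3.Theorems.PercNearOneGluingNoHeavyLowerTailIncStarHalfDegenerate
import HarnessLib

/-!
# STAR½ for a star of sure blocks (the base case of the C½ induction in the fixed-vertex formalism)

Support file for the Sahi programme (`--supports stmt-CriticalPhenomena-4575`, prover prim-sahi-p2 gen 19).  No definitions, no named
facts, no sorries; standard axioms.  Memo `FROM-prim-nh-lead-4575-g120-STAR-HALF.md` §5 (lead g120), `prim-sahi-p2/PROOF-E3.md` (29j)–(29k).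

`F = E₃ − ½(P(ABC) − P(A)P(B)P(C))` for the root-connection events `A, B, C = {s↔b}, {s↔c}, {s↔y}`.  **`starHalf_nonneg_of_nonRootDet`**: if every
non-loop pair missing the root has weight `0` or `1` (the environment is a.s. deterministic — a 'star of sure blocks'), then `F ≥ 0`.  This is the
STAR½ analogue of `IncStar.incStar_nonneg_of_nonRootDet` (`…IncStarSlackEdgeBase`) and reuses its dictionary: on the almost-sure set each event is a
ROOT-STAR PROXY `{∃ open root pair into the sure block of the target}` (`openConn_iff_rootStar_of_det`), and two proxies are equal or determined by
disjoint sets of root pairs (`rootStarProxy_eq_or_disjoint`).  If two of the three proxies coincide, `IncStar.starHalf_nonneg_of_eq` (Harris only,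
`…IncStarHalfDegenerate`) applies; otherwise the three are independent and `F = 0`.  Base case of both routes to THEOREM C½ in Lean ((29j): no positive
environment pair; (29k): no fractional one).
-/

noncomputable section

namespace Summit.CriticalPhenomena.PercolationContinuityZ3.Theorems

namespace IncStar

open MeasureTheory Set Literature.Probability.Percolation Literature.Probability.LatticeModels EdgeInduction
open scoped Classical

variable {n : ℕ}

/-- `F` is unchanged when the three events are replaced by almost surely equal ones. [folklore] -/
theorem starHalf_congr_of_sure {μ : Measure (BondConfig (Fin n))} [IsProbabilityMeasure μ] {G : Set (BondConfig (Fin n))}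
    (hGm : MeasurableSet G) (hG : μ.real G = 1) {A B C A' B' C' : Set (BondConfig (Fin n))}
    (hA : ∀ ω ∈ G, ω ∈ A ↔ ω ∈ A') (hB : ∀ ω ∈ G, ω ∈ B ↔ ω ∈ B') (hC : ∀ ω ∈ G, ω ∈ C ↔ ω ∈ C') :
    sahiE3 μ A B C - 1 / 2 * (μ.real (A ∩ B ∩ C) - μ.real A * μ.real B * μ.real C)
      = sahiE3 μ A' B' C' - 1 / 2 * (μ.real (A' ∩ B' ∩ C') - μ.real A' * μ.real B' * μ.real C') := by
  have key : ∀ S S' : Set (BondConfig (Fin n)), (∀ ω ∈ G, ω ∈ S ↔ ω ∈ S') → μ.real S = μ.real S' := by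
    intro S S' h
    rw [real_eq_real_inter_of_real_eq_one hGm hG S, real_eq_real_inter_of_real_eq_one hGm hG S']
    congr 1
    ext ω
    simp only [Set.mem_inter_iff]
    constructor
    · rintro ⟨hS, hω⟩; exact ⟨(h ω hω).1 hS, hω⟩
    · rintro ⟨hS, hω⟩; exact ⟨(h ω hω).2 hS, hω⟩
  have hABC : ∀ ω ∈ G, ω ∈ A ∩ B ∩ C ↔ ω ∈ A' ∩ B' ∩ C' := fun ω hω => by
    simp only [Set.mem_inter_iff, hA ω hω, hB ω hω, hC ω hω]
  rw [sahiE3_congr_of_sure hGm hG hA hB hC, key _ _ hABC, key _ _ hA, key _ _ hB, key _ _ hC]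

/-- `F` is symmetric in its first two slots. [folklore] -/
theorem starHalf_comm₁₂ (μ : Measure (BondConfig (Fin n))) (A B C : Set (BondConfig (Fin n))) :
    sahiE3 μ A B C - 1 / 2 * (μ.real (A ∩ B ∩ C) - μ.real A * μ.real B * μ.real C)
      = sahiE3 μ B A C - 1 / 2 * (μ.real (B ∩ A ∩ C) - μ.real B * μ.real A * μ.real C) := by
  rw [sahiE3_comm₁₂, Set.inter_comm A B]; ring

/-- `F` is symmetric in its last two slots. [folklore] -/
theorem starHalf_comm₂₃ (μ : Measure (BondConfig (Fin n))) (A B C : Set (BondConfig (Fin n))) :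
    sahiE3 μ A B C - 1 / 2 * (μ.real (A ∩ B ∩ C) - μ.real A * μ.real B * μ.real C)
      = sahiE3 μ A C B - 1 / 2 * (μ.real (A ∩ C ∩ B) - μ.real A * μ.real C * μ.real B) := by
  rw [sahiE3_comm₂₃, Set.inter_assoc, Set.inter_comm B C, ← Set.inter_assoc]; ring

/-- **`F ≥ 0` for three root-star proxies** (any weight; `H` without edges at the root): two of them coincide (then Harris,
`starHalf_nonneg_of_eq`) or all three are independent (then `F = 0`). [this work] -/
theorem starHalf_rootStarProxy_nonneg (w : Sym2 (Fin n) → unitInterval) (s b c y : Fin n) (H : SimpleGraph (Fin n))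
    (hH : ∀ u, H.Reachable u s → u = s) :
    0 ≤ sahiE3 (prodBernoulli w)
        {ω : BondConfig (Fin n) | b = s ∨ ∃ u, u ≠ s ∧ s(s, u) ∈ ω ∧ H.Reachable u b}
        {ω : BondConfig (Fin n) | c = s ∨ ∃ u, u ≠ s ∧ s(s, u) ∈ ω ∧ H.Reachable u c}
        {ω : BondConfig (Fin n) | y = s ∨ ∃ u, u ≠ s ∧ s(s, u) ∈ ω ∧ H.Reachable u y}
      - 1 / 2 * ((prodBernoulli w).real
          ({ω : BondConfig (Fin n) | b = s ∨ ∃ u, u ≠ s ∧ s(s, u) ∈ ω ∧ H.Reachable u b}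
            ∩ {ω : BondConfig (Fin n) | c = s ∨ ∃ u, u ≠ s ∧ s(s, u) ∈ ω ∧ H.Reachable u c}
            ∩ {ω : BondConfig (Fin n) | y = s ∨ ∃ u, u ≠ s ∧ s(s, u) ∈ ω ∧ H.Reachable u y})
        - (prodBernoulli w).real {ω : BondConfig (Fin n) | b = s ∨ ∃ u, u ≠ s ∧ s(s, u) ∈ ω ∧ H.Reachable u b}
          * (prodBernoulli w).real {ω : BondConfig (Fin n) | c = s ∨ ∃ u, u ≠ s ∧ s(s, u) ∈ ω ∧ H.Reachable u c}
          * (prodBernoulli w).real {ω : BondConfig (Fin n) | y = s ∨ ∃ u, u ≠ s ∧ s(s, u) ∈ ω ∧ H.Reachable u y}) := by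
  set Pb := {ω : BondConfig (Fin n) | b = s ∨ ∃ u, u ≠ s ∧ s(s, u) ∈ ω ∧ H.Reachable u b}
  set Pc := {ω : BondConfig (Fin n) | c = s ∨ ∃ u, u ≠ s ∧ s(s, u) ∈ ω ∧ H.Reachable u c}
  set Py := {ω : BondConfig (Fin n) | y = s ∨ ∃ u, u ≠ s ∧ s(s, u) ∈ ω ∧ H.Reachable u y}
  have hup := fun t => rootStarProxy_isUpperSet s t H
  have hdb := fun t => rootStarProxy_determinedBy s t H
  have hm : ∀ X : Set (BondConfig (Fin n)), MeasurableSet X := fun _ => MeasurableSet.of_discrete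
  rcases rootStarProxy_eq_or_disjoint s b c H hH with hbc | hbc
  · -- `Pb = Pc`
    have e : Pc = Pb := hbc.symm
    rw [e]
    exact starHalf_nonneg_of_eq w (hup b) (hup y) (hm _) (hm _)
  rcases rootStarProxy_eq_or_disjoint s b y H hH with hby | hby
  · have e : Py = Pb := hby.symm
    rw [e, starHalf_comm₂₃]
    exact starHalf_nonneg_of_eq w (hup b) (hup c) (hm _) (hm _)
  rcases rootStarProxy_eq_or_disjoint s c y H hH with hcy | hcy
  · have e : Py = Pc := hcy.symm
    rw [e, starHalf_comm₁₂, starHalf_comm₂₃]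
    exact starHalf_nonneg_of_eq w (hup c) (hup b) (hm _) (hm _)
  -- all three pairwise independent: `F = 0`
  have ibc : (prodBernoulli w).real (Pb ∩ Pc) = (prodBernoulli w).real Pb * (prodBernoulli w).real Pc :=
    prodBernoulli_real_inter_of_determinedBy_disjoint w hbc (hdb b) (hdb c) (hm _) (hm _)
  have iby : (prodBernoulli w).real (Pb ∩ Py) = (prodBernoulli w).real Pb * (prodBernoulli w).real Py :=
    prodBernoulli_real_inter_of_determinedBy_disjoint w hby (hdb b) (hdb y) (hm _) (hm _)
  have icy : (prodBernoulli w).real (Pc ∩ Py) = (prodBernoulli w).real Pc * (prodBernoulli w).real Py :=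
    prodBernoulli_real_inter_of_determinedBy_disjoint w hcy (hdb c) (hdb y) (hm _) (hm _)
  have ibcy : (prodBernoulli w).real (Pb ∩ Pc ∩ Py)
      = (prodBernoulli w).real Pb * (prodBernoulli w).real Pc * (prodBernoulli w).real Py := by
    have hdet : DeterminedBy (Pb ∩ Pc)
        (↑((Finset.univ.filter fun g : Sym2 (Fin n) => ∃ u, u ≠ s ∧ g = s(s, u) ∧ H.Reachable u b)
          ∪ (Finset.univ.filter fun g : Sym2 (Fin n) => ∃ u, u ≠ s ∧ g = s(s, u) ∧ H.Reachable u c)) : Set (Sym2 (Fin n))) := by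
      rw [Finset.coe_union]
      exact ((hdb b).mono Set.subset_union_left).inter ((hdb c).mono Set.subset_union_right)
    rw [prodBernoulli_real_inter_of_determinedBy_disjoint w (Finset.disjoint_union_left.2 ⟨hby, hcy⟩) hdet (hdb y) (hm _) (hm _), ibc]
  rw [sahiE3_def, ibcy, ibc, iby, icy]
  have : (prodBernoulli w).real (Pb ∩ Py) = (prodBernoulli w).real Pb * (prodBernoulli w).real Py := iby
  nlinarith [this]

/-- **STAR½ for a star of sure blocks.**  If every non-loop pair missing the root has weight `0` or `1`, then
`F = E₃({s↔b},{s↔c},{s↔y}) − ½(P(all three) − ΠP) ≥ 0`. [this work] -/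
theorem starHalf_nonneg_of_nonRootDet (w : Sym2 (Fin n) → unitInterval) (s b c y : Fin n)
    (hdet : ∀ e : Sym2 (Fin n), ¬ e.IsDiag → s ∉ e → w e = 0 ∨ w e = 1) :
    0 ≤ sahiE3 (prodBernoulli w) (openConn s b) (openConn s c) (openConn s y)
      - 1 / 2 * ((prodBernoulli w).real (openConn s b ∩ openConn s c ∩ openConn s y)
        - (prodBernoulli w).real (openConn s b) * (prodBernoulli w).real (openConn s c) * (prodBernoulli w).real (openConn s y)) := by
  have hGm : MeasurableSet ({ω : BondConfig (Fin n) | ∀ e, w e = 1 → e ∈ ω} ∩ {ω | ∀ e, w e = 0 → e ∉ ω}) :=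
    MeasurableSet.of_discrete
  have hG := real_sureSet w
  have hiff : ∀ t : Fin n, ∀ ω ∈ ({ω : BondConfig (Fin n) | ∀ e, w e = 1 → e ∈ ω} ∩ {ω | ∀ e, w e = 0 → e ∉ ω}),
      ω ∈ openConn s t ↔ ω ∈ {ω : BondConfig (Fin n) | t = s ∨ ∃ u, u ≠ s ∧ s(s, u) ∈ ω ∧
        (SimpleGraph.fromEdgeSet {e : Sym2 (Fin n) | w e = 1 ∧ s ∉ e}).Reachable u t} :=
    fun t ω hω => openConn_iff_rootStar_of_det w s hdet hω.1 hω.2 t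
  rw [starHalf_congr_of_sure hGm hG (hiff b) (hiff c) (hiff y)]
  exact starHalf_rootStarProxy_nonneg w s b c y _ fun u hu => eq_root_of_reachable_missing w hu

end IncStar

end Summit.CriticalPhenomena.PercolationContinuityZ3.Theorems
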